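import Literature.MathematicalPhysics.QuantumLattice.KagomeLattice
import HarnessLib

/-!
# Discharges for the kagome lattice (`KagomeLattice`): `kagomeEdge` is a bijection onto the edges of `𝕋`

Topic `MathematicalPhysics/QuantumLattice`. Sibling proof file of
`Literature/MathematicalPhysics/QuantumLattice/KagomeLattice.lean`: it discharges the named fact
`kagomeEdge_bijective` (`def … : Prop`, D-0014) of that file as
`theorem kagomeEdge_bijective_holds : kagomeEdge_bijective`, from Mathlib and the accepted files
`LatticeGraph` (`zdGraph_adj_iff`) and `TriangularLattice` (`triGraph_adj_iff`, `triDiag`).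
No statement is introduced or changed here.

Discharged:

* `Literature.MathematicalPhysics.QuantumLattice.kagomeEdge_bijective_holds :
  kagomeEdge_bijective` — the map `(x, s) ↦ kagomeEdge (x, s)` from the kagome sites
  `KagomeVertex = ℤ² × Fin 3` to the edge set of the triangular lattice `triGraph` is a bijection
  (the kagome lattice is the medial lattice of `𝕋`: one kagome site at the midpoint of every edge
  of `𝕋`).

Auxiliary (public, reusable): `kagomeEdge_injective` and `exists_kagomeEdge_eq_of_mem_edgeSet`
(every edge of `𝕋` is some `kagomeEdge v`).

## Proof

Edges of `𝕋 = triGraph` on `ℤ²` are, by `triGraph_adj_iff` and `zdGraph_adj_iff`, exactly the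
pairs `{a, a + e₀}`, `{a, a + e₁}` and `{a, a + (e₀ - e₁)}` (`triDiag = (1, -1) = e₀ - e₁`),
`a ∈ ℤ²`. By definition `kagomeEdge (x, 0) = {x, x + e₀}`, `kagomeEdge (x, 1) = {x, x + e₁}`,
`kagomeEdge (x, 2) = {x + e₀, x + e₁}`. Surjectivity: the three edge types are
`kagomeEdge (a, 0)`, `kagomeEdge (a, 1)` and `kagomeEdge (a - e₁, 2)` respectively.
Injectivity: if `kagomeEdge (x, s) = kagomeEdge (y, t)` then (`Sym2.eq_iff`) the two unordered
pairs have the same endpoints; comparing coordinates (a linear system over `ℤ` in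
`x 0, x 1, y 0, y 1`, closed by `omega` in each of the `9` cases `(s, t)`) forces `s = t` (the
direction classes `±e₀`, `±e₁`, `±(e₀ - e₁)` are distinct) and then `x = y`.

## Sources

Savary–Balents, *Quantum spin liquids: a review*, Rep. Prog. Phys. **80** (2017) 016502
(arXiv:1601.03742): the kagomé lattice as the lattice of corner-sharing triangles, §6.4.2
"Kagomé models" and §7.1.1 "Frustration" (arXiv numbering) [cite: SavaryBalents2017, §6.4.2 and
§7.1.1]. The source contains no proof of this elementary lattice-geometry statement (kagome =
medial lattice of the triangular lattice = line graph of the honeycomb lattice); it is proved here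
by direct computation in the coordinates of `KagomeLattice.lean`.
-/

namespace Literature.MathematicalPhysics.QuantumLattice

open Literature.Probability.LatticeModels

/-- `kagomeEdge` is injective: the edge `kagomeEdge (x, s)` of `𝕋` determines the sublattice `s`
(its direction class `±e₀`, `±e₁`, `±(e₀ - e₁)`) and then the cell `x` (its endpoints). Direct
computation on the encoding `KagomeVertex = ℤ² × Fin 3`; the kagomé lattice as the lattice of
corner-sharing triangles is described in Savary–Balents, arXiv:1601.03742, §6.4.2 ("Kagomé
models") and §7.1.1. [cite: SavaryBalents2017, §6.4.2 and §7.1.1] -/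
theorem kagomeEdge_injective : Function.Injective kagomeEdge := by
  rintro ⟨x, s⟩ ⟨y, t⟩ h
  fin_cases s <;> fin_cases t <;>
    simp only [kagomeEdge, Fin.zero_eta, Fin.mk_one, Fin.reduceFinMk, Matrix.cons_val_zero,
      Matrix.cons_val_one, Matrix.cons_val, Sym2.eq_iff, funext_iff, Fin.forall_fin_two,
      Pi.add_apply, Pi.single_apply, Prod.mk.injEq] at h ⊢ <;>
    simp at h ⊢ <;> omega

/-- Every edge of `𝕋` is the edge of some kagome site: `{a, a + e₀} = kagomeEdge (a, 0)`,
`{a, a + e₁} = kagomeEdge (a, 1)` and the diagonal `{a, a + (e₀ - e₁)} = kagomeEdge (a - e₁, 2)`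
(by `triGraph_adj_iff`, `zdGraph_adj_iff` these are all the edges of `𝕋`).
(Savary–Balents, arXiv:1601.03742, §6.4.2, §7.1.1: kagomé = corner-sharing triangles.) [cite: SavaryBalents2017, §6.4.2 and §7.1.1] -/
theorem exists_kagomeEdge_eq_of_mem_edgeSet (e : Sym2 (Site 2)) (he : e ∈ triGraph.edgeSet) :
    ∃ v, kagomeEdge v = e := by
  induction e using Sym2.ind with
  | h a b =>
    rw [SimpleGraph.mem_edgeSet, triGraph_adj_iff, zdGraph_adj_iff] at he
    rcases he with ⟨i, h | h⟩ | h | h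
    · fin_cases i
      · exact ⟨(a, 0), by simp [kagomeEdge, h]⟩
      · exact ⟨(a, 1), by simp [kagomeEdge, h]⟩
    · fin_cases i
      · exact ⟨(b, 0), by rw [Sym2.eq_swap]; simp [kagomeEdge, h]⟩
      · exact ⟨(b, 1), by rw [Sym2.eq_swap]; simp [kagomeEdge, h]⟩
    · refine ⟨(a - Pi.single 1 1, 2), ?_⟩
      rw [Sym2.eq_swap]
      simp only [kagomeEdge, Matrix.cons_val, sub_add_cancel, h]
      congr 1
      ext i; fin_cases i <;> simp [triDiag, sub_eq_add_neg]
    · refine ⟨(b - Pi.single 1 1, 2), ?_⟩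
      simp only [kagomeEdge, Matrix.cons_val, sub_add_cancel, h]
      congr 1
      ext i; fin_cases i <;> simp [triDiag, sub_eq_add_neg]

/-- **Discharge of `kagomeEdge_bijective`**: `kagomeEdge` is a bijection from the kagome sites
`ℤ² × Fin 3` onto the edge set of the triangular lattice `𝕋`, i.e. the kagome lattice is the
medial lattice of `𝕋` (injectivity `kagomeEdge_injective`, surjectivity
`exists_kagomeEdge_eq_of_mem_edgeSet`). The source describes the kagomé lattice as the lattice
of corner-sharing triangles (Savary–Balents, *Quantum spin liquids: a review*, Rep. Prog. Phys.
**80** (2017) 016502 = arXiv:1601.03742, §6.4.2 "Kagomé models" and §7.1.1 "Frustration"); the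
identification with the edges of `𝕋` in the present coordinates is proved here by direct
computation. [cite: SavaryBalents2017, §6.4.2 and §7.1.1] -/
theorem kagomeEdge_bijective_holds : kagomeEdge_bijective := by
  refine ⟨fun v w h => kagomeEdge_injective (congrArg Subtype.val h), fun e => ?_⟩
  obtain ⟨v, hv⟩ := exists_kagomeEdge_eq_of_mem_edgeSet e.1 e.2
  exact ⟨v, Subtype.ext hv⟩

end Literature.MathematicalPhysics.QuantumLattice
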